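import Mathlib.MeasureTheory.Group.Measure
import Summits.ABC.IUTFork.Cor312InterfacesNonVacuity
import Summits.ABC.IUTFork.LanaRealContainer
import Summits.ABC.IUTFork.Cor312Remarks2
import Summits.ABC.IUTFork.LanaStrips
import HarnessLib

/-!
# [IUTchIII] Cor. 3.12 cone — NON-VACUITY II: `IndData` at the REAL container `(⊕_j K_j, μ_Λ)`,
# `Cor312Rmk.LogColumn`, and `DPrimeStrip.MonoAnalyticisation` (given open augmentations)

PROOF-ONLY support file of the abc-iut cell (wave-5 prover seat abc-iut-w5-d114, gen 3; follow-up of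
`Cor312InterfacesNonVacuity` p424709 for the ADJUDICATION-SPEC §4 (iii) register, C312 column — rows of this seat's
05:4xZ kernel inhabitation census of `Summits.ABC.IUTFork`). TAKES NO SIDE on [IUTchIII] Cor. 3.12.
NO `def` / `instance` / `structure` / notation; witnesses inside theorem terms; honest labels.

1. **`IndData` at abc-iut-c312-4's REAL container** `realContainer K Λ` (`LanaRealContainer`: carrier `⊕_j K_j`, a
   finite direct sum of proper ultrametric normed fields; admissible = measurable of finite nonzero `μ_Λ`-measure for
   an integral structure `Λ` — campaign-S `IntegralStructure.haar`, "the volume of `VC(O)` is `1`"; `ln ν̄ = log μ_Λ`;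
   hull = campaign-S `holomorphicHull`, the smallest `λ·O_L ⊇ U`, [IUTchIII] Rmk. 3.9.5 (i)). For `λ`, `q` with all
   components nonzero and `A ⊆ λ·O_L`: `IndData.exists_realContainer_model` — bare region `A`, (Ind3)-region `λ·O_L`,
   `q`-image `q·O_L`, (Ind1) = (Ind2) := the set-stabiliser of `λ·O_L` in `Sym(⊕_j K_j)` (p424709's
   `exists_stabilizer_model`); every possible image is `λ·O_L`, its hull is itself (`holomorphicHull_hullSet`), so
   `−|log(Θ)| = log μ_Λ(λ·O_L)`, `−|log(q)| = log μ_Λ(q·O_L)`, XVIII's «(Ind1), (Ind2) preserve `ln ν̄`» HOLDS, and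
   Reading 1 reads `log μ_Λ(λ·O_L) = log μ_Λ(q·O_L)` — admissibility DISCHARGED by c312-4's `hullSetRegion`;
   `IndData.exists_realContainer_model_self` — with `q := λ`, Reading 1 and the setting's `Cor312` both HOLD on
   genuine Haar measure. MODEL witness: the intended CONTAINER, but indeterminacies acting trivially on the region
   (not LDH's `Ind2Elt × Ind1Elt`) and no Θ-pilot.
2. **`Cor312Rmk.LogColumn`** ([IUTchIII] Rmk 3.12.2 (iv)/(v) one-column record, abc-iut's `Cor312Remarks2`):
   `LogColumn.nonempty` (DEGENERATE) and `LogColumn.exists_lebesgue_model` (LEBESGUE-TRANSLATION MODEL: regions ⊆ `ℝ`,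
   the log-link map := translation by `1`, `vol := log ∘ Lebesgue`, compatibility = translation invariance; `lg` moves
   `[0,1]`, so `vol_iterate` is non-trivial there).
3. **`DPrimeStrip.MonoAnalyticisation`** (LANA §3.10 p. 22, anabelian input N9, abc-iut-c312-4's `LanaStrips`):
   `nonempty_continuousMulEquiv_quotientKer_of_isOpenMap` (topological first isomorphism theorem for an open
   surjection — generic) and `MonoAnalyticisation.nonempty_of_isOpenMap`: GIVEN that every reference augmentation
   `ρ_v : Π_v ↠ G_v` is an open map (true of the genuine profinite data, not recorded in `RefLocalDatum`), EVERY
   `D`-prime-strip carries the datum (transport `ρ_v` along the copy-isomorphism, `Δ := ker`). CONDITIONAL MODEL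
   witness of the TYPE; the anabelian RECONSTRUCTION of `Δ` from `Π_v` alone is not touched.

[cite: DupuyHilado2025, §4.11 p. 16, §1 pp. 3–4] [cite: LANA2026Report, §3.10 p. 22, §5.2 (d)(e) p. 29]
[cite: Mochizuki2012, IUTchIII Rmk. 3.9.5 (i) p. 127, Rmk 3.12.2 (v) p. 194] Classical content only;
typed ≠ proved; instantiated ≠ endorsed.
-/

noncomputable section

open MeasureTheory Set Metric Bornology
open Literature.IUT.LogVolume

namespace Summit.ABC
namespace IUTFork
namespace IndData

open Pointwise

variable {J : Type} [Fintype J] (K : J → Type) [∀ j, NontriviallyNormedField (K j)]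
  [MeasurableSpace (Π j, K j)] [BorelSpace (Π j, K j)] (Λ : IntegralStructure (Π j, K j))
  [∀ j, ProperSpace (K j)] [∀ j, IsUltrametricDist (K j)]

/-- **`IndData` at the REAL container `(⊕_j K_j, μ_Λ)`**: for `λ`, `q` with all components nonzero and `A ⊆ λ·O_L`,
indeterminacy data with bare region `A`, (Ind3)-region `λ·O_L`, `q`-image `q·O_L` and (Ind1) = (Ind2) := the
set-stabiliser of `λ·O_L`; `−|log(Θ)| = log μ_Λ(λ·O_L)` (a hull-set is its own holomorphic hull), `−|log(q)| = log μ_Λ(q·O_L)`,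
XVIII's «(Ind1), (Ind2) preserve `ln ν̄`» holds, Reading 1 ↔ `log μ_Λ(λ·O_L) = log μ_Λ(q·O_L)`. Admissibility inputs
discharged by `hullSetRegion` / `holomorphicHull_hullSet`. MODEL witness. [cite: DupuyHilado2025, §4.11 p. 16] -/
theorem exists_realContainer_model (c q : Π j, K j) (hc : ∀ j, c j ≠ 0) (hq : ∀ j, q j ≠ 0)
    {A : Set (Π j, K j)} (hA : A ⊆ hullSet K c) :
    ∃ I : IndData (realContainer K Λ),
      I.G₁ = ↥(MulAction.stabilizer (Equiv.Perm (Π j, K j)) (hullSet K c)) ∧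
      I.G₂ = ↥(MulAction.stabilizer (Equiv.Perm (Π j, K j)) (hullSet K c)) ∧
      I.bare = A ∧ I.bare3 = hullSet K c ∧ I.Q = hullSet K q ∧
      (∀ p : I.G₂ × I.G₁, I.toSetting.U p = hullSet K c) ∧
      (∀ (g₂ : I.G₂) (g₁ : I.G₁),
        (realContainer K Λ).logvol (g₂ • g₁ • I.bare3) = (realContainer K Λ).logvol I.bare3) ∧
      I.toSetting.negLogTheta = Λ.logVolume (hullSet K c) ∧ I.toSetting.negAbsLogq = Λ.logVolume (hullSet K q) ∧
      (I.toSetting.RepresentedVol ↔ Λ.logVolume (hullSet K c) = Λ.logVolume (hullSet K q)) := by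
  have hB : (realContainer K Λ).Adm (hullSet K c) :=
    Region.adm Λ.haar (hullClosureOperator K) (hullSetRegion K Λ c hc)
  have hQ : (realContainer K Λ).Adm (hullSet K q) :=
    Region.adm Λ.haar (hullClosureOperator K) (hullSetRegion K Λ q hq)
  have hhull : (realContainer K Λ).hull (hullSet K c) = hullSet K c := by
    rw [realContainer_hull_apply, holomorphicHull_hullSet]
  have hhB : (realContainer K Λ).Adm ((realContainer K Λ).hull (hullSet K c)) := by
    rw [hhull]
    exact hB
  obtain ⟨I, h1, h2, h3, h4, h5, h6, h7, h8, h9, h10⟩ :=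
    exists_stabilizer_model (V := realContainer K Λ) hA hB hhB hQ
  refine ⟨I, h1, h2, h3, h4, h5, h6, h7, ?_, h9, ?_⟩
  · rw [h8, hhull]
    rfl
  · rw [h10]
    exact Iff.rfl

/-- … in particular with `q := λ`: at the real container Reading 1 (`RepresentedVol`) and the setting's inequality
`Cor312` (`−|log(q)| ≤ −|log(Θ)|`) both HOLD — XVII's readings are jointly satisfiable on genuine Haar measure, for
every integral structure `Λ` and every `λ` with nonzero components. MODEL witness. [cite: DupuyHilado2025, §1 pp. 3–4] -/
theorem exists_realContainer_model_self (c : Π j, K j) (hc : ∀ j, c j ≠ 0) :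
    ∃ I : IndData (realContainer K Λ), I.bare3 = hullSet K c ∧ I.Q = hullSet K c ∧
      I.toSetting.negLogTheta = Λ.logVolume (hullSet K c) ∧ I.toSetting.RepresentedVol ∧ I.toSetting.Cor312 := by
  obtain ⟨I, -, -, -, h4, h5, -, -, h8, h9, h10⟩ :=
    exists_realContainer_model K Λ c c hc hc (subset_refl (hullSet K c))
  refine ⟨I, h4, h5, h8, h10.mpr rfl, ?_⟩
  show I.toSetting.negAbsLogq ≤ I.toSetting.negLogTheta
  rw [h8, h9]

end IndData

/-! ## LogColumn -/

namespace Cor312Rmk.LogColumn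

/-- DEGENERATE witness of the one-column record of Rmk 3.12.2 (iv)/(v): one region, the log-link acting as the
identity, log-volume `0` — the four typed fields are jointly satisfiable (and `vol_iterate` is then about something).
[cite: Mochizuki2012, III Rmk 3.12.2 (v) p.194] -/
theorem nonempty : Nonempty LogColumn :=
  ⟨{ Region := PUnit, lg := id, vol := fun _ => 0, compat := fun _ => rfl }⟩

/-- LEBESGUE-TRANSLATION MODEL of the one-column record: regions := subsets of `ℝ`, the map induced by one log-link :=
translation by `1` (pre-image form), log-volume := `log` of Lebesgue measure; log-link compatibility `vol (lg S) = vol S`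
is translation-invariance of Lebesgue measure (Mathlib `measure_preimage_add_right`). The map `lg` is NOT the identity
(it moves `[0,1]`), so `vol_iterate` is a non-trivial statement in this model. MODEL witness — the genuine log-link is
not a measure-preserving bijection of regions; print's compatibility ([IUTchIII] Prop. 3.9 (iv)) concerns specific
regions. [cite: Mochizuki2012, III Rmk 3.12.2 (v) p.194] -/
theorem exists_lebesgue_model :
    ∃ C : LogColumn, C.Region = Set ℝ ∧ (∃ S : C.Region, C.lg S ≠ S) ∧ ∀ n S, C.vol (C.lg^[n] S) = C.vol S := by
  let C : LogColumn :=
    { Region := Set ℝ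
      lg := fun S => (fun x : ℝ => x + 1) ⁻¹' S
      vol := fun S => Real.log ((volume : Measure ℝ) S).toReal
      compat := fun S => by
        show Real.log ((volume : Measure ℝ) ((fun x : ℝ => x + 1) ⁻¹' S)).toReal = Real.log (volume S).toReal
        rw [measure_preimage_add_right] }
  refine ⟨C, rfl, ⟨(Icc (0 : ℝ) 1 : Set ℝ), fun h => ?_⟩, C.vol_iterate⟩
  have h1 : (0 : ℝ) ∈ (fun x : ℝ => x + 1) ⁻¹' (Icc (0 : ℝ) 1 : Set ℝ) := by
    show (0 : ℝ) + 1 ∈ Icc (0 : ℝ) 1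
    norm_num
  have h2 : (-1 : ℝ) ∈ (fun x : ℝ => x + 1) ⁻¹' (Icc (0 : ℝ) 1 : Set ℝ) := by
    show (-1 : ℝ) + 1 ∈ Icc (0 : ℝ) 1
    norm_num
  have h3 : (-1 : ℝ) ∈ (Icc (0 : ℝ) 1 : Set ℝ) := by
    have e : C.lg (Icc (0 : ℝ) 1 : Set ℝ) = (fun x : ℝ => x + 1) ⁻¹' (Icc (0 : ℝ) 1 : Set ℝ) := rfl
    rw [← e, h]  at h2
    exact h2
  norm_num at h3

end Cor312Rmk.LogColumn

/-! ## MonoAnalyticisation -/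

/-- **Topological first isomorphism theorem for an OPEN surjection** (generic helper): a continuous, open, surjective
group homomorphism `f : P → G` induces an isomorphism of topological groups `P ⧸ ker f ≃ₜ* G` (the algebraic
`QuotientGroup.quotientKerEquivOfSurjective` is continuous for the quotient topology and open because `f` is).
[folklore] -/
theorem nonempty_continuousMulEquiv_quotientKer_of_isOpenMap {P G : Type*} [Group P] [TopologicalSpace P]
    [Group G] [TopologicalSpace G] (f : P →* G) (hf : Continuous f) (hsurj : Function.Surjective f)
    (hopen : IsOpenMap f) : Nonempty ((P ⧸ f.ker) ≃ₜ* G) := by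
  classical
  let e : P ⧸ f.ker ≃* G := QuotientGroup.quotientKerEquivOfSurjective f hsurj
  have he : ∀ x : P, e (QuotientGroup.mk x) = f x := fun _ => rfl
  have hcont : Continuous e := by
    refine (QuotientGroup.isQuotientMap_mk f.ker).continuous_iff.2 ?_
    have h : (⇑e ∘ QuotientGroup.mk) = ⇑f := funext fun _ => rfl
    rw [h]
    exact hf
  have hopen' : IsOpenMap e := by
    intro U hU
    have himg : ⇑e '' U = ⇑f '' ((QuotientGroup.mk : P → P ⧸ f.ker) ⁻¹' U) := by
      ext y
      constructor
      · rintro ⟨q, hq, rfl⟩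
        obtain ⟨x, rfl⟩ := QuotientGroup.mk_surjective q
        exact ⟨x, hq, he x⟩
      · rintro ⟨x, hx, rfl⟩
        exact ⟨QuotientGroup.mk x, hx, he x⟩
    rw [himg]
    exact hopen _ (hU.preimage QuotientGroup.continuous_mk)
  let h : (P ⧸ f.ker) ≃ₜ G := Equiv.toHomeomorphOfContinuousOpen e.toEquiv hcont hopen'
  have hinv : Continuous e.symm := by
    have hfun : ⇑e.symm = ⇑h.symm := by
      funext y
      apply e.injective
      rw [e.apply_symm_apply]
      exact (h.apply_symm_apply y).symm
    rw [hfun]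
    exact h.symm.continuous
  exact ⟨{ e with continuous_toFun := hcont, continuous_invFun := hinv }⟩

/-- **`D^⊢` from `D` GIVEN OPEN augmentations** (LANA §3.10 p. 22, the anabelian input N9 typed as
`DPrimeStrip.MonoAnalyticisation`): if every reference surjection `ρ_v : Π_v ↠ G_v` is an OPEN map (true for the genuine
local data — an open continuous surjection of profinite groups — but NOT recorded in `RefLocalDatum`, hence a hypothesis
here), then EVERY `D`-prime-strip admits a mono-analyticisation datum: transport `ρ_v` along the copy-isomorphism
`Π ≃ₜ* Π_v`, take `Δ := ker`, and the quotient is a copy of `G_v` by the topological first isomorphism theorem. This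
witnesses the TYPE (the datum «a normal subgroup with quotient a copy of `G_v`» exists); it is NOT the group-theoretic
RECONSTRUCTION of that subgroup from `Π_v` alone, which is the anabelian content the interface stands for.
CONDITIONAL MODEL witness. [cite: LANA2026Report, §3.10 p. 22] -/
theorem DPrimeStrip.MonoAnalyticisation.nonempty_of_isOpenMap {V : Type} {ref : V → RefLocalDatum}
    (D : DPrimeStrip ref) (hopen : ∀ v, IsOpenMap (ref v).ρ) : Nonempty D.MonoAnalyticisation := by
  classical
  -- the transported augmentations `f_v := ρ_v ∘ φ_v : D.P v → G_v`
  let φ : ∀ v, D.P v ≃ₜ* (ref v).P := fun v => (D.isCopy v).some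
  let f : ∀ v, D.P v →* (ref v).G := fun v => ((ref v).ρ : (ref v).P →* (ref v).G).comp (φ v).toMonoidHom
  have hf : ∀ v, Continuous (f v) := fun v => (ref v).ρ.continuous_toFun.comp (φ v).continuous
  have hsurj : ∀ v, Function.Surjective (f v) := fun v => (ref v).ρ_surjective.comp (φ v).surjective
  have hop : ∀ v, IsOpenMap (f v) := fun v => (hopen v).comp (φ v).toHomeomorph.isOpenMap
  exact ⟨{ Δ := fun v => (f v).ker
           isCopy := fun v => nonempty_continuousMulEquiv_quotientKer_of_isOpenMap (f v) (hf v) (hsurj v) (hop v) }⟩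

end IUTFork
end Summit.ABC

end
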